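import Summits.ValiantsHypothesis.ValiantsHypothesis.Theorems.LacunarySymmetroidMatrixDescartesPivotRankOneFourTwoTwo
import Summits.ValiantsHypothesis.ValiantsHypothesis.Theorems.LacunarySymmetroidMatrixDescartesPivotRankOneReductionOneThree

/-!
# `MatrixDescartes` census — RANK-ONE `(2,4)₁`: `Z₊ ≤ 9` FOR EVERY POSITION OF THE PIVOT (and `≤ 8` unless the split is 1/3 or 3/1)

HONEST FRAMING.  Object-search cell `pub-symmetroid`, seat `val-sym-mdr-p1` (generation 15); helper file `--supports` the crux item
stmt-ValiantsHypothesis-18050 (`Theses.LacunarySymmetroid.MatrixDescartes`, OPEN, on HOLD) with NO closure claim.  Bookkeeping beside the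
crux: it assembles the lineage's kernel pieces for the rank-one `(2,4)₁` cell into ONE statement over all positions of the pivot exponent
among four distinct letter exponents.  Nothing here bears on `MatrixDescartes` in its window, on `DoorA26` / `DoorA34`, registers /
credences, or `VP ≠ VNP`.

**THEOREM (`rankOne_posRoots_le_nine`).**  `J` any real symmetric `2 × 2` matrix, letters `wₖvₖvₖᵀ` (`wₖ > 0`, `vₖ ∈ ℝ²` arbitrary),
exponents `d₀ < d₁ < d₂ < d₃` all different from `e`: the determinant of `X^e J + ∑ₖ wₖ X^{dₖ} vₖvₖᵀ` has AT MOST NINE distinct positive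
roots (Descartes' rule alone allows ten).  By split: `0|4` and `4|0` (all letters on one side of the pivot) and `1|3`, `3|1`: an END
coefficient of the eleven-nomial is a lone pivot-type coefficient, so either it is non-negative (then at most four negative coefficients,
`Z₊ ≤ 8`, `RankOneReduction.elevenNomial_le_eight_of_coeff_nonneg`) or it is negative and the two-ended Descartes budget
(`Census.signVariations_two_ended_le`) gives `9` (`elevenNomial_le_nine_of_end_neg`); `2|2`: `Z₊ ≤ 8` by
`RankOneCover.rankOne_twoTwo_posRoots_le_eight`.  So the rank-one value set of the `(2,4)₁` cell is `{8, 9}`, and `9` can only come from the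
chambers (C), (C′) of the 1/3, 3/1 splits (`…PivotRankOneReductionOneThree`: `≤ 7` off them).

[folklore] Descartes' rule with the two-ended budget; the lineage's files cited above.  No definitions, no named facts.
-/

-- `Summit.ValiantsHypothesis.ValiantsHypothesis.…` repeats a component by the D-0017 layout
-- (single-conjunct summit), which the `dupNamespace` linter flags; the name is mandated.
set_option linter.dupNamespace false

open Polynomial Matrix Finset
open scoped BigOperators
open Summit.ValiantsHypothesis.ValiantsHypothesis.Theorems.LacunarySymmetroidMatrixDescartes.Pivot.TwoDirections.BlockLaw

namespace Summit.ValiantsHypothesis.ValiantsHypothesis.Theorems.LacunarySymmetroidMatrixDescartes.Pivot.RankOneCover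

/-! ## 1. Two-ended Descartes budget for the eleven-nomial -/

/-- If the six pair coefficients are non-negative and an END coefficient (trailing or leading) is negative, the eleven-nomial has at most
nine positive roots: negative coefficients sit at the five pivot-type degrees only, and the two-ended budget
`Var + [lead<0] + [trail<0] ≤ 2·#neg` leaves `Var ≤ 9`. -/
theorem elevenNomial_le_nine_of_end_neg (e d₀ d₁ d₂ d₃ : ℕ) (cv : Fin 11 → ℝ) (hpos : ∀ i : Fin 11, 5 ≤ (i : ℕ) → 0 ≤ cv i)
    (hend : (∑ i : Fin 11, Polynomial.C (cv i) * X ^ ((![2 * e, e + d₀, e + d₁, e + d₂, e + d₃, d₀ + d₁, d₀ + d₂, d₀ + d₃, d₁ + d₂, d₁ + d₃, d₂ + d₃] : Fin 11 → ℕ) i)).trailingCoeff < 0 ∨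
      (∑ i : Fin 11, Polynomial.C (cv i) * X ^ ((![2 * e, e + d₀, e + d₁, e + d₂, e + d₃, d₀ + d₁, d₀ + d₂, d₀ + d₃, d₁ + d₂, d₁ + d₃, d₂ + d₃] : Fin 11 → ℕ) i)).leadingCoeff < 0) :
    ((∑ i : Fin 11, Polynomial.C (cv i) * X ^ ((![2 * e, e + d₀, e + d₁, e + d₂, e + d₃, d₀ + d₁, d₀ + d₂, d₀ + d₃, d₁ + d₂, d₁ + d₃, d₂ + d₃] : Fin 11 → ℕ) i)).roots.toFinset.filter (fun t => 0 < t)).card ≤ 9 := by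
  classical
  set f := (∑ i : Fin 11, Polynomial.C (cv i) * X ^ ((![2 * e, e + d₀, e + d₁, e + d₂, e + d₃, d₀ + d₁, d₀ + d₂, d₀ + d₃, d₁ + d₂, d₁ + d₃, d₂ + d₃] : Fin 11 → ℕ) i)) with hf
  have hneg : ∀ m, f.coeff m < 0 → m = 2 * e ∨ m = e + d₀ ∨ m = e + d₁ ∨ m = e + d₂ ∨ m = e + d₃ :=
    fun m hm => RankOneReduction.eq_pivotDegree_of_coeff_neg e d₀ d₁ d₂ d₃ cv hpos m hm
  have hZ := Census.card_posRoots_le_signVariations f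
  have hb := Census.signVariations_two_ended_le f
  set S : Finset ℕ := {2 * e, e + d₀, e + d₁, e + d₂, e + d₃} with hS
  have hsub : Pivot.TwoDescartes.negSupp f ⊆ S := by
    intro n hn
    simp only [Pivot.TwoDescartes.negSupp, Finset.mem_filter] at hn
    have := hneg n hn.2
    simp only [hS, Finset.mem_insert, Finset.mem_singleton]
    omega
  have hc := Finset.card_le_card hsub
  have h5 : S.card ≤ 5 := Finset.card_le_five
  rcases hend with h | h
  · rw [if_pos h] at hb
    split_ifs at hb <;> omega
  · rw [if_pos h] at hb
    split_ifs at hb <;> omega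

/-- Split `0|4` (`e < d₀ < d₁ < d₂ < d₃`): the lowest degree `2e` is carried by the pivot alone, so the trailing coefficient is `c₀`. -/
theorem trailingCoeff_elevenNomial_zeroFour (e d₀ d₁ d₂ d₃ : ℕ) (he0 : e < d₀) (h01 : d₀ < d₁) (h12 : d₁ < d₂) (h23 : d₂ < d₃)
    (cv : Fin 11 → ℝ) (h0 : cv 0 ≠ 0) :
    (∑ i : Fin 11, Polynomial.C (cv i) * X ^ ((![2 * e, e + d₀, e + d₁, e + d₂, e + d₃, d₀ + d₁, d₀ + d₂, d₀ + d₃, d₁ + d₂, d₁ + d₃, d₂ + d₃] : Fin 11 → ℕ) i)).trailingCoeff = cv 0 := by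
  set f := (∑ i : Fin 11, Polynomial.C (cv i) * X ^ ((![2 * e, e + d₀, e + d₁, e + d₂, e + d₃, d₀ + d₁, d₀ + d₂, d₀ + d₃, d₁ + d₂, d₁ + d₃, d₂ + d₃] : Fin 11 → ℕ) i)) with hf
  have hcoef : f.coeff (2 * e) = cv 0 := by
    rw [hf, RankOneReduction.coeff_elevenNomial, Finset.sum_eq_single (0 : Fin 11)]
    · simp
    · intro i _ hi
      fin_cases i <;> simp at hi ⊢ <;> omega
    · simp
  have hne : f ≠ 0 := fun hz => by
    have := hcoef; rw [hz, coeff_zero] at this; exact h0 this.symm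
  have hge : 2 * e ≤ f.natTrailingDegree := by
    refine le_natTrailingDegree hne fun m hm => ?_
    rw [hf, RankOneReduction.coeff_elevenNomial]
    refine Finset.sum_eq_zero fun i _ => ?_
    rw [if_neg]
    fin_cases i <;> simp <;> omega
  have hle : f.natTrailingDegree ≤ 2 * e := natTrailingDegree_le_of_ne_zero (by rw [hcoef]; exact h0)
  change f.coeff f.natTrailingDegree = cv 0
  rw [le_antisymm hle hge, hcoef]

/-- Split `4|0` (`d₀ < d₁ < d₂ < d₃ < e`): the highest degree `2e` is carried by the pivot alone, so the leading coefficient is `c₀`. -/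
theorem leadingCoeff_elevenNomial_fourZero (e d₀ d₁ d₂ d₃ : ℕ) (h01 : d₀ < d₁) (h12 : d₁ < d₂) (h23 : d₂ < d₃) (h3e : d₃ < e)
    (cv : Fin 11 → ℝ) (h0 : cv 0 ≠ 0) :
    (∑ i : Fin 11, Polynomial.C (cv i) * X ^ ((![2 * e, e + d₀, e + d₁, e + d₂, e + d₃, d₀ + d₁, d₀ + d₂, d₀ + d₃, d₁ + d₂, d₁ + d₃, d₂ + d₃] : Fin 11 → ℕ) i)).leadingCoeff = cv 0 := by
  set f := (∑ i : Fin 11, Polynomial.C (cv i) * X ^ ((![2 * e, e + d₀, e + d₁, e + d₂, e + d₃, d₀ + d₁, d₀ + d₂, d₀ + d₃, d₁ + d₂, d₁ + d₃, d₂ + d₃] : Fin 11 → ℕ) i)) with hf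
  have hcoef : f.coeff (2 * e) = cv 0 := by
    rw [hf, RankOneReduction.coeff_elevenNomial, Finset.sum_eq_single (0 : Fin 11)]
    · simp
    · intro i _ hi
      fin_cases i <;> simp at hi ⊢ <;> omega
    · simp
  have hle : f.natDegree ≤ 2 * e := by
    rw [hf]
    refine natDegree_sum_le_of_forall_le _ _ fun i _ => (natDegree_C_mul_X_pow_le _ _).trans ?_
    fin_cases i <;> simp <;> omega
  have hdeg : f.natDegree = 2 * e := natDegree_eq_of_le_of_coeff_ne_zero hle (by rw [hcoef]; exact h0)
  change f.coeff f.natDegree = cv 0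
  rw [hdeg, hcoef]

/-! ## 2. Every position of the pivot -/

/-- **RANK-ONE `(2,4)₁`: `Z₊ ≤ 9` FOR EVERY POSITION OF THE PIVOT** (`J` real symmetric, `wₖ > 0`, `vₖ` arbitrary, letter exponents
`d₀ < d₁ < d₂ < d₃` all different from the pivot exponent `e`).  The split `2|2` has `Z₊ ≤ 8` (`rankOne_twoTwo_posRoots_le_eight`); the
value `9` can only arise in the 1/3 and 3/1 splits, and there only inside chambers (C), (C′). [this file] -/
theorem rankOne_posRoots_le_nine (e d₀ d₁ d₂ d₃ : ℕ) (h01 : d₀ < d₁) (h12 : d₁ < d₂) (h23 : d₂ < d₃)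
    (he₀ : e ≠ d₀) (he₁ : e ≠ d₁) (he₂ : e ≠ d₂) (he₃ : e ≠ d₃)
    (J : Matrix (Fin 2) (Fin 2) ℝ) (hJ : J 0 1 = J 1 0) (v₀ v₁ v₂ v₃ : Fin 2 → ℝ) (w₀ w₁ w₂ w₃ : ℝ)
    (hw₀ : 0 < w₀) (hw₁ : 0 < w₁) (hw₂ : 0 < w₂) (hw₃ : 0 < w₃) :
    ((Matrix.det (((X : ℝ[X]) ^ e) • J.map Polynomial.C
        + (Polynomial.C w₀ * X ^ d₀) • (vecMulVec v₀ v₀).map Polynomial.C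
        + (Polynomial.C w₁ * X ^ d₁) • (vecMulVec v₁ v₁).map Polynomial.C
        + (Polynomial.C w₂ * X ^ d₂) • (vecMulVec v₂ v₂).map Polynomial.C
        + (Polynomial.C w₃ * X ^ d₃) • (vecMulVec v₃ v₃).map Polynomial.C)).roots.toFinset.filter (fun t => 0 < t)).card
      ≤ 9 := by
  classical
  -- the 2|2 split: eight
  by_cases h22 : d₁ < e ∧ e < d₂
  · exact (rankOne_twoTwo_posRoots_le_eight e d₀ d₁ d₂ d₃ h01 h22.1 h22.2 h23 J hJ v₀ v₁ v₂ v₃ w₀ w₁ w₂ w₃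
      hw₀ hw₁ hw₂ hw₃).trans (by norm_num)
  rw [det_rankOne_four_sum]
  have hpair : ∀ i : Fin 11, 5 ≤ (i : ℕ) →
      0 ≤ (![J.det, w₀ * (J 0 0 * v₀ 1 ^ 2 + J 1 1 * v₀ 0 ^ 2 - (J 0 1 + J 1 0) * (v₀ 0 * v₀ 1)), w₁ * (J 0 0 * v₁ 1 ^ 2 + J 1 1 * v₁ 0 ^ 2 - (J 0 1 + J 1 0) * (v₁ 0 * v₁ 1)), w₂ * (J 0 0 * v₂ 1 ^ 2 + J 1 1 * v₂ 0 ^ 2 - (J 0 1 + J 1 0) * (v₂ 0 * v₂ 1)), w₃ * (J 0 0 * v₃ 1 ^ 2 + J 1 1 * v₃ 0 ^ 2 - (J 0 1 + J 1 0) * (v₃ 0 * v₃ 1)), w₀ * w₁ * ((v₀ 0 * v₁ 1 - v₀ 1 * v₁ 0) ^ 2), w₀ * w₂ * ((v₀ 0 * v₂ 1 - v₀ 1 * v₂ 0) ^ 2), w₀ * w₃ * ((v₀ 0 * v₃ 1 - v₀ 1 * v₃ 0) ^ 2), w₁ * w₂ * ((v₁ 0 * v₂ 1 - v₁ 1 *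 v₂ 0) ^ 2), w₁ * w₃ * ((v₁ 0 * v₃ 1 - v₁ 1 * v₃ 0) ^ 2), w₂ * w₃ * ((v₂ 0 * v₃ 1 - v₂ 1 * v₃ 0) ^ 2)] : Fin 11 → ℝ) i := by
    intro i hi
    fin_cases i <;>
      first
        | (simp only [Fin.isValue, Fin.reduceFinMk, Matrix.cons_val]; positivity)
        | (norm_num at hi)
  by_cases p0 : e < d₀
  · -- split 0|4: the end coefficient at `2e` is `det J`
    by_cases hdet : 0 ≤ J.det
    · refine (RankOneReduction.elevenNomial_le_eight_of_coeff_nonneg e d₀ d₁ d₂ d₃ _ hpair (2 * e) (Or.inl rfl)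
        (coeff_elevenNomial_nonneg e d₀ d₁ d₂ d₃ _ hpair (2 * e) fun i _ h => ?_)).trans (by norm_num)
      fin_cases i <;> simp only [Fin.isValue, Fin.reduceFinMk, Matrix.cons_val] at h ⊢ <;> first | exact hdet | omega
    · push Not at hdet
      refine elevenNomial_le_nine_of_end_neg e d₀ d₁ d₂ d₃ _ hpair (Or.inl ?_)
      rw [trailingCoeff_elevenNomial_zeroFour e d₀ d₁ d₂ d₃ p0 h01 h12 h23 _ (by simpa using hdet.ne)]
      simpa using hdet
  have p0' : d₀ < e := by omega
  by_cases p1 : e < d₁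
  · -- split 1|3: the end coefficient at `e + d₀` is `w₀ m(J,v₀)`
    by_cases hm₀ : 0 ≤ J 0 0 * v₀ 1 ^ 2 + J 1 1 * v₀ 0 ^ 2 - (J 0 1 + J 1 0) * (v₀ 0 * v₀ 1)
    · refine (RankOneReduction.elevenNomial_le_eight_of_coeff_nonneg e d₀ d₁ d₂ d₃ _ hpair (e + d₀) (Or.inr (Or.inl rfl))
        (coeff_elevenNomial_nonneg e d₀ d₁ d₂ d₃ _ hpair (e + d₀) fun i _ h => ?_)).trans (by norm_num)
      fin_cases i <;> simp only [Fin.isValue, Fin.reduceFinMk, Matrix.cons_val] at h ⊢ <;>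
        first | exact mul_nonneg hw₀.le hm₀ | omega
    · push Not at hm₀
      have hneg : w₀ * (J 0 0 * v₀ 1 ^ 2 + J 1 1 * v₀ 0 ^ 2 - (J 0 1 + J 1 0) * (v₀ 0 * v₀ 1)) < 0 := mul_neg_of_pos_of_neg hw₀ hm₀
      refine elevenNomial_le_nine_of_end_neg e d₀ d₁ d₂ d₃ _ hpair (Or.inl ?_)
      rw [RankOneReduction.trailingCoeff_elevenNomial_oneThree e d₀ d₁ d₂ d₃ p0' p1 h12 h23 _ (by simpa using hneg.ne)]
      simpa using hneg
  have p1' : d₁ < e := by omega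
  have p2' : d₂ < e := by
    rcases lt_or_gt_of_ne he₂ with h | h
    · exact absurd ⟨p1', h⟩ h22
    · exact h
  by_cases p3 : e < d₃
  · -- split 3|1: the end coefficient at `e + d₃` is `w₃ m(J,v₃)`
    by_cases hm₃ : 0 ≤ J 0 0 * v₃ 1 ^ 2 + J 1 1 * v₃ 0 ^ 2 - (J 0 1 + J 1 0) * (v₃ 0 * v₃ 1)
    · refine (RankOneReduction.elevenNomial_le_eight_of_coeff_nonneg e d₀ d₁ d₂ d₃ _ hpair (e + d₃)
        (Or.inr (Or.inr (Or.inr (Or.inr rfl))))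
        (coeff_elevenNomial_nonneg e d₀ d₁ d₂ d₃ _ hpair (e + d₃) fun i _ h => ?_)).trans (by norm_num)
      fin_cases i <;> simp only [Fin.isValue, Fin.reduceFinMk, Matrix.cons_val] at h ⊢ <;>
        first | exact mul_nonneg hw₃.le hm₃ | omega
    · push Not at hm₃
      have hneg : w₃ * (J 0 0 * v₃ 1 ^ 2 + J 1 1 * v₃ 0 ^ 2 - (J 0 1 + J 1 0) * (v₃ 0 * v₃ 1)) < 0 := mul_neg_of_pos_of_neg hw₃ hm₃
      refine elevenNomial_le_nine_of_end_neg e d₀ d₁ d₂ d₃ _ hpair (Or.inr ?_)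
      rw [RankOneReduction.leadingCoeff_elevenNomial_threeOne e d₀ d₁ d₂ d₃ h01 h12 p2' p3 _ (by simpa using hneg.ne)]
      simpa using hneg
  have p3' : d₃ < e := by omega
  -- split 4|0: the end coefficient at `2e` is `det J`
  by_cases hdet : 0 ≤ J.det
  · refine (RankOneReduction.elevenNomial_le_eight_of_coeff_nonneg e d₀ d₁ d₂ d₃ _ hpair (2 * e) (Or.inl rfl)
      (coeff_elevenNomial_nonneg e d₀ d₁ d₂ d₃ _ hpair (2 * e) fun i _ h => ?_)).trans (by norm_num)
    fin_cases i <;> simp only [Fin.isValue, Fin.reduceFinMk, Matrix.cons_val] at h ⊢ <;> first | exact hdet | omega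
  · push Not at hdet
    refine elevenNomial_le_nine_of_end_neg e d₀ d₁ d₂ d₃ _ hpair (Or.inr ?_)
    rw [leadingCoeff_elevenNomial_fourZero e d₀ d₁ d₂ d₃ h01 h12 h23 p3' _ (by simpa using hdet.ne)]
    simpa using hdet

end Summit.ValiantsHypothesis.ValiantsHypothesis.Theorems.LacunarySymmetroidMatrixDescartes.Pivot.RankOneCover
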